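import Summits.BirchSwinnertonDyer.Rank1Residual.Partition.EisensteinKernelAbscissaType
import Summits.BirchSwinnertonDyer.Rank1Residual.Partition.EisensteinKernelCertificate
import Summits.BirchSwinnertonDyer.Rank1Residual.X2.Cells
import Literature.NumberTheory.EllipticCurves.TateCurve.NumberFieldUniformization
import Literature.NumberTheory.EllipticCurves.TateCurve.NumberFieldUniformizationTwisted
import HarnessLib

/-!
# Crux 3 `MazurMCOnCellB` (stmt-BirchSwinnertonDyer-19033) — the ABSCISSA CERTIFICATE of cell X2b at `p = 3` as ONE generic theorem
# (the §1 step that every file of the (Z) CLASS ATLAS at `p = 3` instantiates)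

Width seat bsd-line-x2-p1-w8 (gen 7), cell `bsd-eis`, 2026-08-29; `--supports stmt-BirchSwinnertonDyer-19033 --as helper`. THEOREMS ONLY
(no `def`, no named fact, no `sorry`, no instance). Host RULING L117 (d): «the ONE structural theorem per reduction type that the atlases
instantiate». The (Z) CLASS ATLAS at `p = 3` (`…TwistbackShaUnitClassP3Atlas001–210`, 701 classes) certifies `X2.CellB E₁ 3` per class in
five steps: `Ψ₃(x₀) = 0` (norm_num) · `Ψ₂Sq(x₀) ≠ 0` (norm_num) · the rational `3`-line it spans (`KernelDisc.exists_isRationalLine_of_eval_Ψ₃_eq_zero`)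
· `¬ GVPar` from `KernelDisc.gvPar_three_iff_abscissa_of_mult` (`GVPar W 3 ↔ (0 < b₂ + 12x₀ ↔ den x₀ ≠ 1)`) · assembly with the rank reading. This
file packages the steps ONCE, generically in the curve, so that a per-class certificate is ONE application + two `norm_num` side goals:

* §1 `not_irr_three_of_eval_Ψ₃` — a rational root of `Ψ₃` on an elliptic `W/ℚ` makes `W[3]` reducible (the separability input
  `Ψ₂Sq(x₀) ≠ 0` is automatic: `KernelDisc.eval_Ψ₂Sq_ne_zero_of_eval_Ψ₃`).
* §2 `not_gvPar_three_of_int_root_of_pos` — globally minimal `W`, multiplicative at `3`, an INTEGER root `x₀ = n` with `0 < b₂ + 12n`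
  (the unramified-even line) ⟹ `¬ GVPar W 3`; `not_gvPar_three_of_root_of_den_ne_one_of_neg` — a NON-integral root with `b₂ + 12x₀ < 0`
  (the ramified-odd line) ⟹ `¬ GVPar W 3`; and the two X2a twins `gvPar_three_of_int_root_of_neg` / `gvPar_three_of_root_of_den_ne_one_of_pos`.
* §3 `cellB_three_of_int_root_of_pos` / `cellB_three_of_root_of_den_ne_one_of_neg` — `X2.CellB W 3` from the rank reading `r_an(W) = 0`,
  multiplicative reduction at `3` and the abscissa datum; `cellA_three_of_int_root_of_neg` / `cellA_three_of_root_of_den_ne_one_of_pos` (X2a).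
* §4 `classX2_three_of_eval_Ψ₃` — `ClassX2 W 3` from multiplicative reduction at `3` and any rational `Ψ₃`-root.

The Tate-uniformisation inputs of `gvPar_three_iff_abscissa_of_mult` are discharged by the tree's `_holds`
(`Silverman1994_thmV53_tateUniformisation_holds`, `Silverman1994_thmV53_corV54_tateUniformisation_holds`), as in every display of the line.

HONEST FRAMING: UNCONDITIONAL kernel lemmas (no named fact, no reading except the explicit hypothesis `r_an(W) = 0` of §3); they prove
no case of Mazur's main conjecture or of BSD; no registered stub is closed; 0 cells / labels / tiers move; no summit statement is proved.

References: [SilvermanAEC2009] III Ex. 3.7, III.2.3, VII.5 Prop. 5.1; [SilvermanATAEC1994] Thm. V.5.3, Cor. V.5.4; [GreenbergVatsal2000]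
Thm. (1.3), §2 p. 28 (the parity predicate); HOME `run/shared/lean/pub/bsd-eis/` RULING L117.
-/

set_option autoImplicit false
-- `Summit.BirchSwinnertonDyer.BirchSwinnertonDyer.…`: the summit and its single sub-problem share a name.
set_option linter.dupNamespace false

noncomputable section

open scoped Classical
open WeierstrassCurve Literature.NumberTheory.EllipticCurves Literature.NumberTheory.EllipticCurves.Rank1Residual
  Literature.NumberTheory.EllipticCurves.TateCurve
  Summit.BirchSwinnertonDyer.Rank1Residual

namespace Summit.BirchSwinnertonDyer.BirchSwinnertonDyer.Theorems.EisensteinPrimesMazurMCOnCellBAbscissaCellB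

variable {W : WeierstrassCurve ℚ}

/-! ## §1. Reducibility of `W[3]` from a rational root of `Ψ₃` -/

/-- **A rational root of `Ψ₃` makes `W[3]` reducible** (elliptic `W/ℚ`): `Ψ₂Sq(x₀) ≠ 0` is automatic
(`KernelDisc.eval_Ψ₂Sq_ne_zero_of_eval_Ψ₃`), so `x₀` spans a rational `3`-line (`KernelDisc.exists_isRationalLine_of_eval_Ψ₃_eq_zero`),
which is a proper non-trivial `Γ_ℚ`-submodule of `W[3]`. [cite: SilvermanAEC2009, III Ex. 3.7 and III.2.3] -/
theorem not_irr_three_of_eval_Ψ₃ [W.IsElliptic] {x₀ : ℚ} (hψ : W.Ψ₃.eval x₀ = 0) :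
    ¬ W.HasIrreducibleModPGaloisRep 3 := by
  obtain ⟨Φ, P, y, h, hΦ, -⟩ :=
    KernelDisc.exists_isRationalLine_of_eval_Ψ₃_eq_zero (W := W) x₀ hψ (KernelDisc.eval_Ψ₂Sq_ne_zero_of_eval_Ψ₃ hψ)
  exact not_hasIrreducibleModPGaloisRep_of_isRationalLine hΦ

/-! ## §2. The GV parity at a multiplicative `3` from the abscissa -/

/-- **`¬ GVPar W 3` from an INTEGER root with positive sign** (globally minimal `W`, multiplicative at `3`, `Ψ₃(n) = 0`, `0 < b₂ + 12n`:
the unramified-even line). [cite: SilvermanATAEC1994, Thm. V.5.3 and Cor. V.5.4] [cite: GreenbergVatsal2000, Thm. (1.3) and §2 p. 28] -/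
theorem not_gvPar_three_of_int_root_of_pos [W.IsElliptic] [W.IsGloballyMinimal]
    (hmult : W.HasMultiplicativeReductionAtPrime 3) {n : ℤ} (hψ : W.Ψ₃.eval (n : ℚ) = 0) (hpos : 0 < W.b₂ + 12 * (n : ℚ)) :
    ¬ GVPar W 3 := by
  intro h
  have key := (KernelDisc.gvPar_three_iff_abscissa_of_mult (W := W) Silverman1994_thmV53_tateUniformisation_holds
    Silverman1994_thmV53_corV54_tateUniformisation_holds hmult hψ).mp h
  have hden : ((n : ℚ)).den = 1 := Rat.den_intCast n
  exact (key.mp hpos) hden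

/-- **`¬ GVPar W 3` from a NON-integral root with negative sign** (`den x₀ ≠ 1`, `b₂ + 12x₀ < 0`: the ramified-odd line).
[cite: SilvermanATAEC1994, Thm. V.5.3 and Cor. V.5.4] [cite: GreenbergVatsal2000, Thm. (1.3) and §2 p. 28] -/
theorem not_gvPar_three_of_root_of_den_ne_one_of_neg [W.IsElliptic] [W.IsGloballyMinimal]
    (hmult : W.HasMultiplicativeReductionAtPrime 3) {x₀ : ℚ} (hψ : W.Ψ₃.eval x₀ = 0) (hden : x₀.den ≠ 1)
    (hneg : W.b₂ + 12 * x₀ < 0) : ¬ GVPar W 3 := by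
  intro h
  have key := (KernelDisc.gvPar_three_iff_abscissa_of_mult (W := W) Silverman1994_thmV53_tateUniformisation_holds
    Silverman1994_thmV53_corV54_tateUniformisation_holds hmult hψ).mp h
  exact absurd (key.mpr hden) (not_lt.mpr hneg.le)

/-- **`GVPar W 3` from an INTEGER root with negative sign** (the unramified-odd line: cell X2a). [cite: SilvermanATAEC1994, Thm. V.5.3 and Cor. V.5.4]
[cite: GreenbergVatsal2000, Thm. (1.3) and §2 p. 28] -/
theorem gvPar_three_of_int_root_of_neg [W.IsElliptic] [W.IsGloballyMinimal]
    (hmult : W.HasMultiplicativeReductionAtPrime 3) {n : ℤ} (hψ : W.Ψ₃.eval (n : ℚ) = 0) (hneg : W.b₂ + 12 * (n : ℚ) < 0) :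
    GVPar W 3 := by
  refine (KernelDisc.gvPar_three_iff_abscissa_of_mult (W := W) Silverman1994_thmV53_tateUniformisation_holds
    Silverman1994_thmV53_corV54_tateUniformisation_holds hmult hψ).mpr ⟨fun hpos => ?_, fun hden => ?_⟩
  · exact absurd hpos (not_lt.mpr hneg.le)
  · exact absurd (Rat.den_intCast n) hden

/-- **`GVPar W 3` from a NON-integral root with positive sign** (the ramified-even line: cell X2a). [cite: SilvermanATAEC1994, Thm. V.5.3 and Cor. V.5.4]
[cite: GreenbergVatsal2000, Thm. (1.3) and §2 p. 28] -/
theorem gvPar_three_of_root_of_den_ne_one_of_pos [W.IsElliptic] [W.IsGloballyMinimal]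
    (hmult : W.HasMultiplicativeReductionAtPrime 3) {x₀ : ℚ} (hψ : W.Ψ₃.eval x₀ = 0) (hden : x₀.den ≠ 1)
    (hpos : 0 < W.b₂ + 12 * x₀) : GVPar W 3 :=
  (KernelDisc.gvPar_three_iff_abscissa_of_mult (W := W) Silverman1994_thmV53_tateUniformisation_holds
    Silverman1994_thmV53_corV54_tateUniformisation_holds hmult hψ).mpr ⟨fun _ => hden, fun _ => hpos⟩

/-! ## §3. The cells from the rank reading and the abscissa datum -/

/-- **`ClassX2 W 3` from multiplicative reduction at `3` and any rational `Ψ₃`-root.** [cite: SilvermanAEC2009, III Ex. 3.7] -/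
theorem classX2_three_of_eval_Ψ₃ [W.IsElliptic] (hmult : W.HasMultiplicativeReductionAtPrime 3) {x₀ : ℚ}
    (hψ : W.Ψ₃.eval x₀ = 0) : ClassX2 W 3 :=
  ⟨by decide, not_irr_three_of_eval_Ψ₃ hψ, hmult⟩

/-- **`X2.CellB W 3` from the rank reading, multiplicative reduction at `3` and an INTEGER root with positive sign** — the §1 of every
(Z)-atlas class whose Ш-unit member carries the unramified-even line (8 592 of the 8 618 tabulated Ш-unit classes).
[cite: GreenbergVatsal2000, Thm. (1.3) and §2 p. 28] [cite: SilvermanATAEC1994, Thm. V.5.3 and Cor. V.5.4] -/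
theorem cellB_three_of_int_root_of_pos [W.IsElliptic] [W.IsGloballyMinimal] (hr : W.analyticRank = 0)
    (hmult : W.HasMultiplicativeReductionAtPrime 3) {n : ℤ} (hψ : W.Ψ₃.eval (n : ℚ) = 0) (hpos : 0 < W.b₂ + 12 * (n : ℚ)) :
    X2.CellB W 3 :=
  ⟨hr, classX2_three_of_eval_Ψ₃ hmult hψ, not_gvPar_three_of_int_root_of_pos hmult hψ hpos⟩

/-- **`X2.CellB W 3` from the rank reading, multiplicative reduction at `3` and a NON-integral root with negative sign** (the 26
tabulated Ш-unit classes whose only unit member carries the ramified-odd line, e.g. `60702d2`, `93318e2`).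
[cite: GreenbergVatsal2000, Thm. (1.3) and §2 p. 28] [cite: SilvermanATAEC1994, Thm. V.5.3 and Cor. V.5.4] -/
theorem cellB_three_of_root_of_den_ne_one_of_neg [W.IsElliptic] [W.IsGloballyMinimal] (hr : W.analyticRank = 0)
    (hmult : W.HasMultiplicativeReductionAtPrime 3) {x₀ : ℚ} (hψ : W.Ψ₃.eval x₀ = 0) (hden : x₀.den ≠ 1)
    (hneg : W.b₂ + 12 * x₀ < 0) : X2.CellB W 3 :=
  ⟨hr, classX2_three_of_eval_Ψ₃ hmult hψ, not_gvPar_three_of_root_of_den_ne_one_of_neg hmult hψ hden hneg⟩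

/-- **`X2.CellA W 3` (the Greenberg–Vatsal cell) from the rank reading, multiplicative `3` and an INTEGER root with negative sign.**
[cite: GreenbergVatsal2000, Thm. (1.3) and §2 p. 28] [cite: SilvermanATAEC1994, Thm. V.5.3 and Cor. V.5.4] -/
theorem cellA_three_of_int_root_of_neg [W.IsElliptic] [W.IsGloballyMinimal] (hr : W.analyticRank = 0)
    (hmult : W.HasMultiplicativeReductionAtPrime 3) {n : ℤ} (hψ : W.Ψ₃.eval (n : ℚ) = 0) (hneg : W.b₂ + 12 * (n : ℚ) < 0) :
    X2.CellA W 3 :=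
  ⟨hr, classX2_three_of_eval_Ψ₃ hmult hψ, gvPar_three_of_int_root_of_neg hmult hψ hneg⟩

/-- **`X2.CellA W 3` from the rank reading, multiplicative `3` and a NON-integral root with positive sign.**
[cite: GreenbergVatsal2000, Thm. (1.3) and §2 p. 28] [cite: SilvermanATAEC1994, Thm. V.5.3 and Cor. V.5.4] -/
theorem cellA_three_of_root_of_den_ne_one_of_pos [W.IsElliptic] [W.IsGloballyMinimal] (hr : W.analyticRank = 0)
    (hmult : W.HasMultiplicativeReductionAtPrime 3) {x₀ : ℚ} (hψ : W.Ψ₃.eval x₀ = 0) (hden : x₀.den ≠ 1)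
    (hpos : 0 < W.b₂ + 12 * x₀) : X2.CellA W 3 :=
  ⟨hr, classX2_three_of_eval_Ψ₃ hmult hψ, gvPar_three_of_root_of_den_ne_one_of_pos hmult hψ hden hpos⟩

/-! ## §4. The dichotomy for the record: every rational `Ψ₃`-root decides the cell -/

/-- **At a rank-`0` multiplicative `3` with a rational `Ψ₃`-root, `W` is in cell X2a or in cell X2b, and the abscissa decides which:**
X2b iff `¬ (0 < b₂ + 12x₀ ↔ den x₀ ≠ 1)`. (The census of this seat evaluates exactly this predicate on 12 669 classes: 3 924 X2a / 8 745 X2b.)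
[cite: GreenbergVatsal2000, Thm. (1.3) and §2 p. 28] [cite: SilvermanATAEC1994, Thm. V.5.3 and Cor. V.5.4] -/
theorem cellB_three_iff_abscissa_of_eval_Ψ₃ [W.IsElliptic] [W.IsGloballyMinimal] (hr : W.analyticRank = 0)
    (hmult : W.HasMultiplicativeReductionAtPrime 3) {x₀ : ℚ} (hψ : W.Ψ₃.eval x₀ = 0) :
    X2.CellB W 3 ↔ ¬ (0 < W.b₂ + 12 * x₀ ↔ x₀.den ≠ 1) := by
  rw [← KernelDisc.gvPar_three_iff_abscissa_of_mult (W := W) Silverman1994_thmV53_tateUniformisation_holds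
    Silverman1994_thmV53_corV54_tateUniformisation_holds hmult hψ]
  exact ⟨fun hc => hc.2.2, fun h => ⟨hr, classX2_three_of_eval_Ψ₃ hmult hψ, h⟩⟩

end Summit.BirchSwinnertonDyer.BirchSwinnertonDyer.Theorems.EisensteinPrimesMazurMCOnCellBAbscissaCellB

end
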